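/-
Copyright (c) 2026 the pub-hodgecm-mathlib formalisation cell (harness21).  Prover seat hodgecm-mathlib-K2Liu-p01 (g2): Track B «K2-LIT»,
#184♮ = hLiu418 = stmt-HodgeConjecture-24832, STEWARD of socket #41; organ O41.5 (Gindikin–Karpelevich), ROADMAP
`K2/K2Liu-p01/g2/ROADMAP-O41_5-GindikinKarpelevich.K2Liup01g2.md` a6873eb1b770b760, sub-organ O41.5c (algebraic half).
-/
import Literature.NumberTheory.GelbartRogawski1991.LocalDoubledUnitaryUnramifiedCell   -- ★ `nElem`, `IsIntegralAt`, `apply_mem_glInt_of_isIntegralAt`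
import Literature.NumberTheory.GelbartRogawski1991.DoubledUnitaryAdaptedRelations      -- ★ `rel₂₂`, `adapt_eq`
import Literature.NumberTheory.K2Lit.LocalSiegelIntertwining                          -- ★ D10 `unipDeltaLocal`, `mem_unipDeltaLocal_iff(_blocks)`
import HarnessLib

/-!
# Crux `HLiu418`, road `K2_Liu`, socket #41, organ O41.5c (algebraic half): COORDINATES ON `N_Δ(F_v)` —
# `t ↦ n(t)` is an isomorphism `(Skew_{T₀}(E ⊗ F_v), +) ≅ N_Δ(F_v)`, and `N_Δ(F_v) ∩ H(𝒪_v) = n(integral skew)`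

Cell `hodgecm-mathlib`, crux item hLiu418 = `stmt-HodgeConjecture-24832`; squad K2 ∕ K2Liu; prover K2Liu-p01 (g2), steward of #41.
THEOREMS ONLY (no `def`, no instance, no notation, no named-fact hypothesis, no `sorry`); lane `--supports stmt-HodgeConjecture-24832`.

THE STATEMENTS (general rank `n`, the GR91 local frame `H(F_v) = U(T₀ ⊕ −T₀)(F_v)`, ★ `unipDeltaLocal` of D10, ★ `nElem t ht` of
`LocalDoubledUnitaryUnramifiedCell` for a `T₀`-skew `t` over `E ⊗ F_v`, i.e. `σ(t)ᵀ T + T t = 0`, `T = gramS = T₀ ⊗ 1`):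
* §1 `skew_blkB_of_mem_unipDeltaLocal` — for `u ∈ N_Δ(F_v)` the adapted corner `B(u)` is `T₀`-skew (★ `rel₂₂` of the unitarity relation ★ `cstar_matA`
  with `A = D = 1`, `C = 0`);  `eq_nElem_of_mem_unipDeltaLocal` — **`u = n(B(u))`**: every element of `N_Δ(F_v)` IS an `nElem`.
* §2 the group law: `nElem_add` (`n(t + t') = n(t)·n(t')`), `nElem_zero'` (`n(0) = 1`), `blkB_matA_nElem` (`B(n(t)) = t`), `nElem_injective`;
  so **`t ↦ n(t)` is an isomorphism of groups `(Skew, +) ≅ (N_Δ(F_v), ·)`** (stated as these four facts — no new definition).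
* §3 INTEGRALITY: `isIntegralAt_matA_of_mem_localInt'` (any `v`, any `w ∣ v` — the ★ lemma without its non-split hypothesis),
  `isIntegralAt_blkB_of_mem_localInt` (`u ∈ N_Δ ∩ K_v`, `|2|_w = 1` ⇒ `B(u)` integral at `w`), `nElem_mem_localInt'` (`t` integral at every `w ∣ v`,
  `|2|_w = 1` ⇒ `n(t) ∈ K_v`, split or not) ⇒ **`N_Δ(F_v) ∩ H(𝒪_v) = n({integral skew t})`** at every place with `|2|_w = 1`.
USE (ROADMAP O41.5c∕d): a Haar measure `νN` on `N_Δ(F_v)` is, through `n`, a Haar measure on the additive group of skew matrices (a free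
`𝒪_v`-lattice-bearing `F_v`-space of dimension `n²·[E:F]/…`; at `n = 2`: coordinates `(a, z, d) ∈ F_v × E_w × F_v`), and `νN(N_Δ ∩ K_v)` is the
measure of the integral skew matrices — the normalising volume of the Gindikin–Karpelevich identity.  The TOPOLOGICAL half (continuity of
`n` and of `B ∘ matA`, Haar transport) is the sequel file.  [HarrisKudlaSweet1996, §1 (1.11)–(1.12)] [Kudla1994, §3] [Casselman1980, §3].
HONEST LABEL.  Count-neutral helper; it retires nothing by itself: `HC_CM` is proved only modulo the 7 printed citations (2 remaining named inputs:
hLiu418 = `stmt-HodgeConjecture-24832`, h413 = `stmt-HodgeConjecture-24833`) until rung 0 closes.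

## References
* [HarrisKudlaSweet1996] M. Harris, S. Kudla, W. J. Sweet, J. AMS 9 (1996): §1 (1.11)–(1.12) (`N_Δ ≅ Herm_n`).
* [Kudla1994] S. S. Kudla, Israel J. Math. 87 (1994): §3.   * [Casselman1980] W. Casselman, Compositio Math. 40 (1980): §3.
* [PlatonovRapinchuk1994] V. Platonov, A. Rapinchuk, *Algebraic Groups and Number Theory* (1994): §5.1 (integral points).
-/

set_option autoImplicit false
set_option linter.dupNamespace false -- the mandated namespace repeats `HodgeConjecture.HodgeConjecture`

noncomputable section

open NumberField IsDedekindDomain Matrix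
open scoped ValuativeRel
open Literature.NumberTheory.Automorphic Literature.NumberTheory.Automorphic.UnitaryGroup
open Literature.NumberTheory.GelbartRogawski1991.AdaptedBlocks
open Literature.NumberTheory.GelbartRogawski1991.UnitaryDualPair.LocalSplitting
open Literature.NumberTheory.K2Lit.LocalSiegelDoubled

namespace Summit.HodgeConjecture.HodgeConjecture.Cruxes.HLiu418.K2LiuUnipDeltaLocalCoordinates

variable (F : Type) [Field F] [NumberField F] (E : Type) [Field E] [NumberField E] [Algebra F E]
  [Algebra.IsQuadraticExtension F E] (c : E ≃ₐ[F] E)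
  (v : HeightOneSpectrum (𝓞 F)) (n : ℕ) {T₀ : Matrix (Fin n) (Fin n) F}
  {JD : Matrix (Fin (n + n)) (Fin (n + n)) E} (hJD : JD = (gramD F n T₀).map (algebraMap F E))

/-! ## §1 Every element of `N_Δ(F_v)` is an `n(t)` with `t` skew -/

omit [Algebra.IsQuadraticExtension F E] in
include hJD in
/-- **the adapted corner `B(u)` of `u ∈ N_Δ(F_v)` is `T₀`-skew**: `σ(B)ᵀ T + T B = 0` (★ `rel₂₂` of ★ `cstar_matA` with `D = 1`).
[cite: HarrisKudlaSweet1996, §1 (1.12)] [cite: Kudla1994, §3] -/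
theorem skew_blkB_of_mem_unipDeltaLocal {u : UnitaryGroup.localPi E c (n + n) JD v} (hu : u ∈ unipDeltaLocal F E c v n (JD := JD)) :
    ((blkB (matA F E c v n u)).map (conjLocal E c v))ᵀ * gramS F E v n T₀ + gramS F E v n T₀ * blkB (matA F E c v n u) = 0 := by
  obtain ⟨-, -, hD⟩ := (mem_unipDeltaLocal_iff_blocks F E c v n u).1 hu
  have h := rel₂₂ (cstar_matA F E c v n hJD u)
  rw [hD, Matrix.map_one _ (map_zero _) (map_one _), Matrix.transpose_one, Matrix.one_mul, Matrix.mul_one, add_comm] at h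
  exact h

omit [Algebra.IsQuadraticExtension F E] in
include hJD in
/-- **`u = n(B(u))`** for `u ∈ N_Δ(F_v)`: every element of the local Siegel unipotent radical is one of the ★ `nElem`.
[cite: HarrisKudlaSweet1996, §1 (1.11)] [cite: Kudla1994, §3] -/
theorem eq_nElem_of_mem_unipDeltaLocal {u : UnitaryGroup.localPi E c (n + n) JD v} (hu : u ∈ unipDeltaLocal F E c v n (JD := JD)) :
    u = nElem F E c v n hJD (blkB (matA F E c v n u)) (skew_blkB_of_mem_unipDeltaLocal F E c v n hJD hu) := by
  obtain ⟨hC, hA, hD⟩ := (mem_unipDeltaLocal_iff_blocks F E c v n u).1 hu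
  refine matA_injective F E c v n (eq_of_adapt_eq ?_)
  rw [adapt_matA_nElem, adapt_eq, hA, hC, hD]

/-! ## §2 The group law of `t ↦ n(t)` -/

omit [Algebra.IsQuadraticExtension F E] in
/-- sums of skew matrices are skew. [folklore] -/
theorem skew_add {t t' : Matrix (Fin n) (Fin n) (LocalRing E v)}
    (ht : (t.map (conjLocal E c v))ᵀ * gramS F E v n T₀ + gramS F E v n T₀ * t = 0)
    (ht' : (t'.map (conjLocal E c v))ᵀ * gramS F E v n T₀ + gramS F E v n T₀ * t' = 0) :
    ((t + t').map (conjLocal E c v))ᵀ * gramS F E v n T₀ + gramS F E v n T₀ * (t + t') = 0 := by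
  rw [Matrix.map_add _ (map_add _), Matrix.transpose_add, Matrix.add_mul, Matrix.mul_add, add_add_add_comm, ht, ht', add_zero]

omit [Algebra.IsQuadraticExtension F E] in
/-- `0` is skew. [folklore] -/
theorem skew_zero : ((0 : Matrix (Fin n) (Fin n) (LocalRing E v)).map (conjLocal E c v))ᵀ * gramS F E v n T₀ + gramS F E v n T₀ * 0 = 0 := by
  rw [Matrix.map_zero _ (map_zero _), Matrix.transpose_zero, Matrix.zero_mul, Matrix.mul_zero, add_zero]

omit [Algebra.IsQuadraticExtension F E] in
include hJD in
/-- **`n(t + t') = n(t) · n(t')`** (`(1 t; 0 1)(1 t'; 0 1) = (1 (t+t'); 0 1)`). [cite: HarrisKudlaSweet1996, §1 (1.11)] -/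
theorem nElem_add {t t' : Matrix (Fin n) (Fin n) (LocalRing E v)}
    (ht : (t.map (conjLocal E c v))ᵀ * gramS F E v n T₀ + gramS F E v n T₀ * t = 0)
    (ht' : (t'.map (conjLocal E c v))ᵀ * gramS F E v n T₀ + gramS F E v n T₀ * t' = 0) :
    nElem F E c v n hJD (t + t') (skew_add F E c v n ht ht') = nElem F E c v n hJD t ht * nElem F E c v n hJD t' ht' := by
  refine matA_injective F E c v n (eq_of_adapt_eq ?_)
  rw [adapt_matA_nElem, ← matA_mul, adapt_mul, adapt_matA_nElem, adapt_matA_nElem, Literature.NumberTheory.K2Lit.SiegelDoubled.fromBlocks_unip_mul,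
    add_comm]

omit [Algebra.IsQuadraticExtension F E] in
include hJD in
/-- **`n(0) = 1`.** [cite: HarrisKudlaSweet1996, §1 (1.11)] -/
theorem nElem_zero' : nElem F E c v n hJD (0 : Matrix (Fin n) (Fin n) (LocalRing E v)) (skew_zero F E c v n) = 1 := by
  refine matA_injective F E c v n (eq_of_adapt_eq ?_)
  rw [adapt_matA_nElem, matA_one, adapt_one, Matrix.fromBlocks_one]

omit [Algebra.IsQuadraticExtension F E] in
include hJD in
/-- **`B(n(t)) = t`**: the adapted corner recovers the coordinate. [cite: Kudla1994, §3] -/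
theorem blkB_matA_nElem {t : Matrix (Fin n) (Fin n) (LocalRing E v)}
    (ht : (t.map (conjLocal E c v))ᵀ * gramS F E v n T₀ + gramS F E v n T₀ * t = 0) : blkB (matA F E c v n (nElem F E c v n hJD t ht)) = t := by
  have h := adapt_matA_nElem F E c v n hJD t ht
  rw [adapt_eq] at h
  exact (Matrix.fromBlocks_inj.1 h).2.1

omit [Algebra.IsQuadraticExtension F E] in
include hJD in
/-- **`n` is injective**: `n(t) = n(t') → t = t'`. [cite: Kudla1994, §3] -/
theorem nElem_injective {t t' : Matrix (Fin n) (Fin n) (LocalRing E v)}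
    (ht : (t.map (conjLocal E c v))ᵀ * gramS F E v n T₀ + gramS F E v n T₀ * t = 0)
    (ht' : (t'.map (conjLocal E c v))ᵀ * gramS F E v n T₀ + gramS F E v n T₀ * t' = 0)
    (h : nElem F E c v n hJD t ht = nElem F E c v n hJD t' ht') : t = t' := by
  rw [← blkB_matA_nElem F E c v n hJD ht, ← blkB_matA_nElem F E c v n hJD ht', h]

omit [Algebra.IsQuadraticExtension F E] in
include hJD in
/-- `n(t) ∈ N_Δ(F_v)` and its corner is `t` — the two directions of the bijection `Skew ≅ N_Δ(F_v)` packaged as a round trip.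
[cite: HarrisKudlaSweet1996, §1 (1.11)] -/
theorem exists_unique_skew_of_mem_unipDeltaLocal {u : UnitaryGroup.localPi E c (n + n) JD v} (hu : u ∈ unipDeltaLocal F E c v n (JD := JD)) :
    ∃ t : Matrix (Fin n) (Fin n) (LocalRing E v), ∃ ht : (t.map (conjLocal E c v))ᵀ * gramS F E v n T₀ + gramS F E v n T₀ * t = 0,
      u = nElem F E c v n hJD t ht ∧ ∀ (t' : Matrix (Fin n) (Fin n) (LocalRing E v))
        (ht' : (t'.map (conjLocal E c v))ᵀ * gramS F E v n T₀ + gramS F E v n T₀ * t' = 0), u = nElem F E c v n hJD t' ht' → t' = t :=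
  ⟨blkB (matA F E c v n u), skew_blkB_of_mem_unipDeltaLocal F E c v n hJD hu, eq_nElem_of_mem_unipDeltaLocal F E c v n hJD hu,
    fun _ ht' h => nElem_injective F E c v n hJD ht' _ (h.symm.trans (eq_nElem_of_mem_unipDeltaLocal F E c v n hJD hu))⟩

/-! ## §3 Integrality: `N_Δ(F_v) ∩ H(𝒪_v) = n(integral skew)` -/

omit [Algebra.IsQuadraticExtension F E] in
/-- the matrix over `E ⊗ F_v` of an element of `H(𝒪_v)` is integral at every `w ∣ v` (★ `isIntegralAt_matA_of_mem_localInt` WITHOUT its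
non-split hypothesis: ★ `UnitaryGroup.mem_localInt_iff` reads all `w`). [cite: PlatonovRapinchuk1994, §5.1] -/
theorem isIntegralAt_matA_of_mem_localInt' (w : PlacesOver E v) {k : UnitaryGroup.localPi E c (n + n) JD v}
    (hk : k ∈ UnitaryGroup.localInt E c (n + n) JD v) : IsIntegralAt F E v w (matA F E c v n k) := by
  have h := ((mem_glInt_iff _).1 ((UnitaryGroup.mem_localInt_iff E c (n + n) JD v k).1 hk w)).1
  intro i j
  have hij := h (e₂ n i) (e₂ n j)
  rw [coe_component_eq_matS_map, Valuation.mem_integer_iff] at hij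
  simpa only [matA, Matrix.map_apply, Matrix.reindex_apply, Equiv.symm_symm, Matrix.submatrix_apply] using hij

omit [Algebra.IsQuadraticExtension F E] in
/-- **`u ∈ N_Δ(F_v) ∩ H(𝒪_v)` ⇒ its coordinate `B(u)` is integral at `w`** (`|2|_w = 1`: the adapted frame costs a `½`).
[cite: PlatonovRapinchuk1994, §5.1] [cite: HarrisKudlaSweet1996, §1 (1.11)] -/
theorem isIntegralAt_blkB_of_mem_localInt (w : PlacesOver E v) (h2 : ValuativeRel.valuation (w.1.adicCompletion E) (2 : w.1.adicCompletion E) = 1)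
    {u : UnitaryGroup.localPi E c (n + n) JD v} (hk : u ∈ UnitaryGroup.localInt E c (n + n) JD v) :
    IsIntegralAt F E v w (blkB (matA F E c v n u)) := by
  have h := (isIntegralAt_adapt F E v n w h2 (isIntegralAt_matA_of_mem_localInt' F E c v n w hk)).toBlocks.2.2.1
  rw [adapt_eq, Matrix.toBlocks_fromBlocks₁₂] at h
  exact h

omit [Algebra.IsQuadraticExtension F E] in
include hJD in
/-- **`n(t) ∈ H(𝒪_v)` for `t` integral at every `w ∣ v`** (`|2|_w = 1`; ANY finite `v`, split or not — ★ `nElem_mem_localInt` without `hw`).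
[cite: GelbartRogawski1991, §3.1 (3.1.3)] [cite: PlatonovRapinchuk1994, §5.1] -/
theorem nElem_mem_localInt' {t : Matrix (Fin n) (Fin n) (LocalRing E v)}
    (ht : (t.map (conjLocal E c v))ᵀ * gramS F E v n T₀ + gramS F E v n T₀ * t = 0)
    (h2 : ∀ w : PlacesOver E v, ValuativeRel.valuation (w.1.adicCompletion E) (2 : w.1.adicCompletion E) = 1)
    (hti : ∀ w : PlacesOver E v, IsIntegralAt F E v w t) :
    nElem F E c v n hJD t ht ∈ UnitaryGroup.localInt E c (n + n) JD v := by
  rw [UnitaryGroup.mem_localInt_iff]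
  intro w
  refine apply_mem_glInt_of_isIntegralAt F E c v n w _ (isIntegralAt_matA_nElem F E c v n hJD w (h2 w) ht (hti w)) ?_
  rw [nElem_inv]
  exact isIntegralAt_matA_nElem F E c v n hJD w (h2 w) _ (hti w).neg

omit [Algebra.IsQuadraticExtension F E] in
include hJD in
/-- **`N_Δ(F_v) ∩ H(𝒪_v) = n(integral skew)`**: for `u ∈ N_Δ(F_v)` at a place with `|2|_w = 1` (all `w ∣ v`), `u ∈ H(𝒪_v)` iff its coordinate
`B(u)` is integral at every `w ∣ v`. [cite: PlatonovRapinchuk1994, §5.1] [cite: Casselman1980, §3] -/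
theorem mem_localInt_iff_isIntegralAt_blkB (h2 : ∀ w : PlacesOver E v, ValuativeRel.valuation (w.1.adicCompletion E) (2 : w.1.adicCompletion E) = 1)
    {u : UnitaryGroup.localPi E c (n + n) JD v} (hu : u ∈ unipDeltaLocal F E c v n (JD := JD)) :
    u ∈ UnitaryGroup.localInt E c (n + n) JD v ↔ ∀ w : PlacesOver E v, IsIntegralAt F E v w (blkB (matA F E c v n u)) := by
  refine ⟨fun hk w => isIntegralAt_blkB_of_mem_localInt F E c v n w (h2 w) hk, fun h => ?_⟩
  rw [eq_nElem_of_mem_unipDeltaLocal F E c v n hJD hu]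
  exact nElem_mem_localInt' F E c v n hJD _ h2 h

end Summit.HodgeConjecture.HodgeConjecture.Cruxes.HLiu418.K2LiuUnipDeltaLocalCoordinates

end
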